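import Literature.MathematicalPhysics.QuantumFieldTheory.Balaban1983to89.B9Eq386BondPropagatorTwoBackgroundLetterTower

/-!
# `Balaban1983to89.B9Eq3126KTwoBackgroundLetterTower` — T. Bałaban, *Propagators for lattice gauge theories in a background field*, Commun. Math. Phys. **99** (1985) 389–434
# [Balaban1985BackgroundPropagators] (3.126) p. 420 *«HB = GQ*(QGQ*)⁻¹B»*, (3.132)–(3.133) p. 422 *«The operators (QGQ*)⁻¹, or (QG₁Q*)⁻¹, can be analyzed in the same way as the
# operator (Q′G′²Q′*)⁻¹»*, Thm 3.4 p. 400, (3.84)–(3.86) p. 407: **THE COARSE OPERATOR `K_k(U) = Q_k(U)G₁,k(U)Q_k(U)†` BETWEEN TWO BACKGROUNDS AT THE FLAT BASE — the local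
# letter of `K_k(U) − K_k(1)` with the small factor `α`, constants BEFORE `n, η, m, U`** — the middle factor of the `K⁻¹`-storey
# `K_k(U)⁻¹ − K_k(1)⁻¹ = −K_k(U)⁻¹(K_k(U) − K_k(1))K_k(1)⁻¹` of the (J′) two-background ladders (sequel `B9Eq3126KinvTwoBackgroundLetterTower`), on which the
# `H₁,k = G₁,kQ_k†K_k⁻¹` and `𝔊_k` storeys rest

statement-level skeleton of published theorems with citation tags; proofs where landed; nothing here is a claim about the Yang–Mills mass gap

CITATION HEADER (lean-in-tree rule).  Audit cell `pub-balaban`, sub-cell `t4`, BINDER row NE9; filed by NE9 crux-team LEAF PROVER 01 (`b2b-balaban-t4-ne9-formalise-leaf-01`, gen 101;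
ROUTE (J′), the `K⁻¹` storey; bears_on: R4/N22).  Composition BY NAME: this lineage's gen-100 `B9Eq386BondPropagatorTwoBackgroundLetterTower.exists_letter_G1k_sub_flat` (the bond
storey), `B9Eq382BondPenaltyTwoBackgroundLetterTower.local_QkW_sub_flat`, `B9Eq315QkSingleBondTwoBackgroundLetter.norm_adjoint_QkW_sub_flat_apply_le_local_diagonal` (the two-background
`Q_k` letters); ne9-leaf-03's `B9Eq315QkSingleBondLetter.norm_adjoint_QkW_apply_le_local_sharp`, `B9Eq315QkLocalLetter.local_QkW`; ne9-leaf-05's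
`B9Eq326G1kSupRowClosed.exists_local_letter_G1k` (the MODEL row of `G₁,k` — O-NE9-1, #5 UNRULED), `B9Eq326G1SupRowOfLetters.{letter_comp, letter_add}`.  Source READ first-hand in
the held text layer `paper:balaban1985-cmp99-background-propagators` (journal page = PDF page + 388) pp. 420, 422, 400, 407.  NOTHING of print's proofs is reproduced: [folklore]
telescoping + letter compositions (the pattern of `B9Eq382BondPenaltyTwoBackgroundLetterTower` §2, one more factor).  THE PRINT (verbatim, p. 422): *«… We will not repeat these
considerations here, let us write only bounds. We have (3.132) …»*; p. 400 Thm 3.4: *«… small perturbations of the operators depending on U only.»*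

WHAT IS PROVED (sorry-free; proof lane — 0 `def`; [folklore]).
* **`exists_letter_K_sub_flat`** — `∃ α₀ K κ` BEFORE the bond storey's binder block (VERBATIM that of `exists_letter_G1k_sub_flat`): for every coarse-bond field `z` supported over
  `bpos⁻¹(v)` with `‖z(c′)‖ ≤ F` and every coarse bond `c`: `‖((K_k(U) − K_k(1))z)(c)‖ ≤ K·α·e^{−κ·d_m(c₋,v)}·F`, telescoped as
  `(Q_k(U) − Q_k(1))G₁,k(U)Q_k(U)† + Q_k(1)(G₁,k(U) − G₁,k(1))Q_k(U)† + Q_k(1)G₁,k(1)(Q_k(U)† − Q_k(1)†)` (two `letter_comp` per word, `letter_add`).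
HONEST SCOPE.  Composition BY NAME on the cell's MODEL rows (O-NE9-1, #5 UNRULED); constants crude (NOT print's); flat base only; first order; the smallness windows of `U`, unitarity, the
tower data, the positivity witnesses stay HYPOTHESES; nothing of [B9] (3.132)–(3.133) ∕ Thm 3.4 asserted as printed; «NE9 ⇐ the named binders»; NE9 NOT PRINTED ∕ NOT PROVED; spine
PROVED 0∕9; rung (B)+1 on a finite T⁴ — NOT infinite volume, NOT mass gap, NOT BetaPertH, NOT Clay.  HONEST DEPENDENCY: continuum YM on T⁴ ⇐ BetaPertH ∧ nine spine estimates (0/9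
proved); BetaPertH ⇐ (D1) ∧ (D4) ∧ CAP+tail; G-an2-4 gates asym, D1 and NE2/3/4.  NEW file; nothing modified.  Net new unproved facts: 0.
-/

noncomputable section

open scoped InnerProductSpace ComplexConjugate BigOperators

namespace Literature.MathematicalPhysics.QuantumFieldTheory.Balaban1983to89.B9Eq3126KTwoBackgroundLetterTower

open B4Sect5Torus (TSite tdist tdist_nonneg tdist_triangle tdist_symm torusSum_le tdist_self)
open B4Sect5Proof (latticeConst latticeConst_nonneg)
open B9SectCLatticeCarrier (Bond bpos shift unshift shift_unshift)
open B9Eq311L2Pairing (WL2)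
open B9Eq319QprimeTorus (blockCoord)
open B7Prop1Explicit (U1 Wcx boxVec)
open B11Eq103H1Complex (SiteL2K BondL2K)
open B9Eq310DeltaPrime (plaqHolU plaqHolU_one)
open B9Eq310HessianOperator (adTransportW)
open B9Eq315QTorus (perCfg cornerSite)
open B9Eq315QTower (towerP UlevOf)
open B9Eq315QTowerFlat (perCfg_UlevOf_one_mem_U1 norm_Wcx_UlevOf_one_sub_one_le UlevOf_one)
open B9Eq316TowerFlatIsOneStep (towerP_eq_fineP_pow siteCast)
open B9Eq326OperatorTower (laplaceAk G1k QkW)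
open B9Eq324DeltaPrimeATower (laplacePrimeAk)
open B9Eq349BlockDistanceWeight (tdist_shift_le_one)
open B9Eq315QkLocalLetter (local_QkW)
open B9Eq315QkSingleBondLetter (norm_adjoint_QkW_apply_le_local_sharp)
open B9Eq315QkSingleBondTwoBackgroundLetter (norm_adjoint_QkW_sub_flat_apply_le_local_diagonal)
open B9Eq382BondPenaltyTwoBackgroundLetterTower (local_QkW_sub_flat)
open B9Eq326G1kSupRowClosed (exists_local_letter_G1k)
open B9Eq326G1SupRowOfLetters (letter_comp letter_add)
open B9Eq386BondPropagatorTwoBackgroundLetterTower (exists_letter_G1k_sub_flat)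

variable {d : ℕ} (hd : 1 ≤ d) (L : ℕ) [NeZero L] (hL : 1 ≤ L) (hL3 : 3 ≤ L)
  {𝔸 : Type*} [NormedRing 𝔸] [NormedAlgebra ℂ 𝔸] [CompleteSpace 𝔸] [NormOneClass 𝔸] [StarRing 𝔸] [NormedStarGroup 𝔸] [StarModule ℂ 𝔸] [FiniteDimensional ℂ 𝔸]
  {W : Type*} [NormedAddCommGroup W] [InnerProductSpace ℂ W] [FiniteDimensional ℂ W] (φ : W ≃ₗ[ℂ] 𝔸)
  {Mφ Mφ' : ℝ} (hMφ : 0 ≤ Mφ) (hMφ' : 0 ≤ Mφ') (hφ : ∀ w, ‖φ w‖ ≤ Mφ * ‖w‖) (hφ' : ∀ X, ‖φ.symm X‖ ≤ Mφ' * ‖X‖) (hstar : ∀ X : 𝔸, ‖star X‖ ≤ ‖X‖)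
  {a : ℝ} (ha : 0 < a) {a' : ℝ} (ha' : 0 < a') {r : ℝ} (hr0 : 0 ≤ r) (hr1 : r < 1)
  (τ : 𝔸 →ₗ[ℂ] ℂ) {Cτ : ℝ} (hτ : ∀ X, ‖τ X‖ ≤ Cτ * ‖X‖) (hCτ : 0 ≤ Cτ) {Mτ : ℝ} (hτm : ∀ X Y : 𝔸, ‖τ (X * Y)‖ ≤ Mτ * ‖X‖ * ‖Y‖) (hMτ : 0 ≤ Mτ)
  {ρw : ℝ} (hρw : 0 ≤ ρw)
  (hτ₁ : ∀ X : 𝔸, τ (star X) = conj (τ X)) (hτ₂ : ∀ X Y : 𝔸, τ (X * Y) = τ (Y * X)) (hφτ : ∀ X Y : 𝔸, ⟪φ.symm X, φ.symm Y⟫_ℂ = τ (star X * Y))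
  {ι : Type} [Fintype ι] [DecidableEq ι] (b : Module.Basis ι ℝ 𝔸) {M₂ : ℝ} (hM₂ : 0 ≤ M₂) (hrepr : ∀ (v : 𝔸) (i : ι), |b.repr v i| ≤ M₂ * ‖v‖)
  (AQ : ℝ)

/-! ## The letter of `K_k(U) − K_k(1)` with the small factor -/

include hd hL hL3 hMφ hMφ' hφ hφ' hstar ha ha' hr0 hr1 hτ hCτ hτm hMτ hρw hτ₁ hτ₂ hφτ hM₂ hrepr in
set_option maxHeartbeats 3200000 in
/-- **THE LETTER OF `K_k(U) − K_k(1) = Q_k(U)G₁,k(U)Q_k(U)† − Q_k(1)G₁,k(1)Q_k(1)†` WITH THE SMALL FACTOR `α`**, constants before the lattice — telescoped as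
`(Q_k(U) − Q_k(1))G₁,k(U)Q_k(U)† + Q_k(1)(G₁,k(U) − G₁,k(1))Q_k(U)† + Q_k(1)G₁,k(1)(Q_k(U)† − Q_k(1)†)`, each word two `letter_comp`s of the landed letters (the bond storey for
the middle one). [folklore] [cite: Balaban1985BackgroundPropagators, (3.132)–(3.133) p.422, Thm 3.4 p.400, (3.84)–(3.86) p.407, (3.15)–(3.16) p.393] -/
theorem exists_letter_K_sub_flat :
    ∃ α₀ K κ : ℝ, 0 < α₀ ∧ 0 ≤ K ∧ 0 < κ ∧
      ∀ (n : ℕ) (η : ℝ), η * (L : ℝ) ^ (n + 1) = 1 →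
      ∀ (c₀ c₁ : ℝ) [Fact (0 < c₀)] [Fact (0 < c₁)], c₀ * ((L : ℝ) ^ (n + 1)) ^ d = c₁ → |η| ^ d / c₀ ≤ ρw →
      ∀ (m : Fin d → ℕ) [∀ i, NeZero (m i)], (∀ i, 1 ≤ m i) → ∀ (U : Bond d (towerP L m (n + 1)) → 𝔸ˣ) (α : ℝ), 0 ≤ α → α ≤ α₀ →
        (∀ bd, U bd ∈ U1 𝔸) → (∀ bd, ‖(U bd : 𝔸) - 1‖ ≤ α * η) →
        (∀ (x : TSite d (towerP L m (n + 1))) (μ ν : Fin d), ‖(U (shift ν x, μ) : 𝔸) - (U (x, μ) : 𝔸)‖ ≤ α * η ^ 2) →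
        (∀ p : B9SectCLatticeCarrier.Plaq d (towerP L m (n + 1)), ‖(plaqHolU U p : 𝔸) - 1‖ ≤ α * η ^ 2) →
      ∀ (hUst : ∀ bd, star (U bd : 𝔸) = (((U bd)⁻¹ : 𝔸ˣ) : 𝔸))
        (αU : ℕ → ℝ), (∀ j, 0 ≤ αU j) → ∀ (hα1 : ∀ j, αU j ≤ 1 / 64), (∑ j ∈ Finset.range (n + 1), αU j ≤ AQ) →
        ∀ (hU1 : ∀ (j : ℕ) (x : B7Prop1Explicit.Site d) (k : Fin d), perCfg (towerP L m (j + 1)) (UlevOf L m (n + 1) U j) x k ∈ U1 𝔸)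
        (hreg : ∀ (j : ℕ) (y : TSite d (towerP L m j)) (k : Fin d) (ρ' : Fin d → Fin L),
          ‖((Wcx L (perCfg (towerP L m (j + 1)) (UlevOf L m (n + 1) U j)) (cornerSite L y) k (boxVec L ρ') : 𝔸ˣ) : 𝔸) - 1‖ ≤ αU j),
      ∀ (εU : ℕ → ℝ), (∀ j, 0 ≤ εU j) → (∀ j, εU j ≤ 1) → (∀ j < n + 1, εU j ≤ α * r ^ j) →
        (∀ (j : ℕ) (bd : Bond d (towerP L m (j + 1))), ‖(UlevOf L m (n + 1) U j bd : 𝔸) - 1‖ ≤ εU j) →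
        (∀ (j : ℕ) (bd : Bond d (towerP L m (j + 1))), UlevOf L m (n + 1) U j bd ∈ U1 𝔸) →
        (∀ (j : ℕ) (bd : Bond d (towerP L m (j + 1))) (w : W), ‖adTransportW φ (UlevOf L m (n + 1) U j) bd w‖ ≤ ‖w‖) →
      ∀ (hposU' : ∀ x : SiteL2K ℂ d (towerP L m (n + 1)) c₀ W, x ≠ 0 → 0 < RCLike.re ⟪x, laplacePrimeAk L m n φ η U a' (c₁ := c₁) x⟫_ℂ)
        (hposU : ∀ x : BondL2K ℂ d (towerP L m (n + 1)) c₀ W, x ≠ 0 →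
          0 < RCLike.re ⟪x, laplaceAk L m n φ η U hL αU hα1 hU1 hreg τ (c₀ := c₀) (c₁ := c₁) a x⟫_ℂ)
        (hpos'₁ : ∀ x : SiteL2K ℂ d (towerP L m (n + 1)) c₀ W, x ≠ 0 →
          0 < RCLike.re ⟪x, laplacePrimeAk L m n φ η (fun _ : Bond d (towerP L m (n + 1)) => (1 : 𝔸ˣ)) a' (c₁ := c₁) x⟫_ℂ)
        (hpos₁ : ∀ x : BondL2K ℂ d (towerP L m (n + 1)) c₀ W, x ≠ 0 →
          0 < RCLike.re ⟪x, laplaceAk L m n φ η (fun _ : Bond d (towerP L m (n + 1)) => (1 : 𝔸ˣ)) hL (fun _ => 0) (fun _ => by norm_num)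
            (perCfg_UlevOf_one_mem_U1 L m (n + 1)) (norm_Wcx_UlevOf_one_sub_one_le L m (n + 1) (fun _ => 0) (fun _ => le_rfl)) τ
            (c₀ := c₀) (c₁ := c₁) a x⟫_ℂ),
      ∀ (v : TSite d m) (z : BondL2K ℂ d m c₁ W) (F : ℝ),
        (∀ c', bpos c' ≠ v → WL2.equiv ℂ (fun _ : Bond d m => c₁) W z c' = 0) →
        (∀ c', ‖WL2.equiv ℂ (fun _ : Bond d m => c₁) W z c'‖ ≤ F) →
      ∀ c : Bond d m,
        ‖WL2.equiv ℂ (fun _ : Bond d m => c₁) W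
            (QkW L m n φ U hL αU hα1 hU1 hreg (c₀ := c₀) (c₁ := c₁)
                (G1k L m n φ η U hL αU hα1 hU1 hreg τ (c₀ := c₀) (c₁ := c₁) hposU
                  (LinearMap.adjoint (QkW L m n φ U hL αU hα1 hU1 hreg (c₀ := c₀) (c₁ := c₁)) z)) -
              QkW L m n φ (fun _ : Bond d (towerP L m (n + 1)) => (1 : 𝔸ˣ)) hL (fun _ => 0) (fun _ => by norm_num)
                  (perCfg_UlevOf_one_mem_U1 L m (n + 1)) (norm_Wcx_UlevOf_one_sub_one_le L m (n + 1) (fun _ => 0) (fun _ => le_rfl)) (c₀ := c₀) (c₁ := c₁)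
                (G1k L m n φ η (fun _ : Bond d (towerP L m (n + 1)) => (1 : 𝔸ˣ)) hL (fun _ => 0) (fun _ => by norm_num)
                  (perCfg_UlevOf_one_mem_U1 L m (n + 1)) (norm_Wcx_UlevOf_one_sub_one_le L m (n + 1) (fun _ => 0) (fun _ => le_rfl)) τ
                  (c₀ := c₀) (c₁ := c₁) hpos₁
                  (LinearMap.adjoint (QkW L m n φ (fun _ : Bond d (towerP L m (n + 1)) => (1 : 𝔸ˣ)) hL (fun _ => 0) (fun _ => by norm_num)
                    (perCfg_UlevOf_one_mem_U1 L m (n + 1)) (norm_Wcx_UlevOf_one_sub_one_le L m (n + 1) (fun _ => 0) (fun _ => le_rfl)) (c₀ := c₀) (c₁ := c₁)) z))) c‖ ≤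
          K * α * Real.exp (-(κ * tdist m (bpos c) v)) * F := by
  classical
  -- (0) the suppliers, `∃`-first
  obtain ⟨αG, BG, δG, hαG, hBG, hδG, ROWU⟩ :=
    exists_local_letter_G1k hd L hL hL3 φ hMφ hMφ' hφ hφ' hstar ha ha' (ϱ := r) hr0 hr1 τ hτ hCτ hτm hMτ hρw hτ₁ hτ₂ hφτ AQ
  obtain ⟨α₁, B1, δ1, hα₁, hB1, hδ1, ROW1⟩ :=
    exists_local_letter_G1k hd L hL hL3 φ hMφ hMφ' hφ hφ' hstar ha ha' (ϱ := 1 / 2) (by norm_num) (by norm_num) τ hτ hCτ hτm hMτ hρw hτ₁ hτ₂ hφτ 0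
  obtain ⟨αS, KS, κS, hαS, hKS, hκS, HS⟩ :=
    exists_letter_G1k_sub_flat hd L hL hL3 φ hMφ hMφ' hφ hφ' hstar ha ha' hr0 hr1 τ hτ hCτ hτm hMτ hρw hτ₁ hτ₂ hφτ b hM₂ hrepr AQ
  set κ₀ : ℝ := min (min δG δ1) κS with hκ₀
  have hκ₀0 : 0 < κ₀ := lt_min (lt_min hδG hδ1) hκS
  have hκ₀G : κ₀ ≤ δG := (min_le_left _ _).trans (min_le_left _ _)
  have hκ₀1 : κ₀ ≤ δ1 := (min_le_left _ _).trans (min_le_right _ _)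
  have hκ₀S : κ₀ ≤ κS := min_le_right _ _
  set S : ℝ := latticeConst d (κ₀ / 2) with hS
  have hS0 : 0 ≤ S := latticeConst_nonneg d (half_pos hκ₀0).le
  have h1r : 0 < 1 - r := by linarith
  set θ : ℝ := 102 * ((d : ℝ) + 1) ^ 2 * L with hθ
  set EA : ℝ := Real.exp (100 * d * (d + 1) * (L : ℝ) ^ d * AQ) with hEA
  set KQ1 : ℝ := Mφ' * Mφ * Real.exp κ₀ with hKQ1
  set KQd : ℝ := Mφ' * Mφ * (Real.exp (50 * ((d : ℝ) + 1) * AQ) * θ * (1 / (1 - r))) * Real.exp κ₀ with hKQd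
  set KSU : ℝ := Mφ' * Mφ * EA * ((2 * d : ℕ) : ℝ) * Real.exp κ₀ with hKSU
  set KSd : ℝ := Mφ' * Mφ * ((L : ℝ) ^ d * (2 * d * (102 * ((d : ℝ) + 1) ^ 2 * L)) * (1 / (1 - r)) * EA) * ((2 * d : ℕ) : ℝ) * Real.exp κ₀ with hKSd
  have hKQ10 : 0 ≤ KQ1 := by positivity
  have hKQd0 : 0 ≤ KQd := by positivity
  have hKSU0 : 0 ≤ KSU := by positivity
  have hKSd0 : 0 ≤ KSd := by positivity
  set K : ℝ := KSU * BG * S * KQd * S + KSU * KS * S * KQ1 * S + KSd * B1 * S * KQ1 * S with hK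
  have hK0 : 0 ≤ K := by positivity
  refine ⟨min (min αG αS) 1, K, κ₀ / 2, lt_min (lt_min hαG hαS) one_pos, hK0, half_pos hκ₀0, ?_⟩
  intro n η hηL c₀ c₁ _ _ hw hρ m _ hm U α hα hαle hUb hUη hUw hpl hUst αU hα0U hα1 hAQ hU1 hreg εU hε0 hε1 hεr hlev hlev1 hRlev hposU' hposU hpos'₁ hpos₁
    v z F hzv hzF c
  have hαG' : α ≤ αG := hαle.trans ((min_le_left _ _).trans (min_le_left _ _))
  have hαS' : α ≤ αS := hαle.trans ((min_le_left _ _).trans (min_le_right _ _))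
  have hc₀ : (0 : ℝ) < c₀ := Fact.out
  have hLd : (0 : ℝ) < ((L : ℝ) ^ (n + 1)) ^ d := by
    have : (0 : ℝ) < L := by exact_mod_cast hL
    positivity
  haveI : Nonempty (Bond d m) := ⟨(v, ⟨0, hd⟩)⟩
  haveI : Nonempty (Bond d (towerP L m (n + 1))) := ⟨(fun _ => 0, ⟨0, hd⟩)⟩
  have hF : 0 ≤ F := (norm_nonneg _).trans (hzF c)
  have hUgrad : ∀ (x : TSite d (towerP L m (n + 1))) (μ : Fin d), ‖(U (x, μ) : 𝔸) - U (unshift μ x, μ)‖ ≤ α * η ^ 2 := fun x μ => by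
    have h := hUw (unshift μ x) μ μ
    rwa [shift_unshift] at h
  -- names
  set piS : TSite d (towerP L m (n + 1)) → TSite d m := fun x => blockCoord (L ^ (n + 1)) m (siteCast (towerP_eq_fineP_pow L m (n + 1)) x) with hpiS
  set piB : Bond d (towerP L m (n + 1)) → TSite d m := fun b' => piS (bpos b') with hpiB
  set piC : Bond d m → TSite d m := fun c' => c'.1 with hpiC
  set GU := G1k L m n φ η U hL αU hα1 hU1 hreg τ (c₀ := c₀) (c₁ := c₁) hposU with hGU
  set G1 := G1k L m n φ η (fun _ : Bond d (towerP L m (n + 1)) => (1 : 𝔸ˣ)) hL (fun _ => 0) (fun _ => by norm_num)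
    (perCfg_UlevOf_one_mem_U1 L m (n + 1)) (norm_Wcx_UlevOf_one_sub_one_le L m (n + 1) (fun _ => 0) (fun _ => le_rfl)) τ (c₀ := c₀) (c₁ := c₁) hpos₁ with hG1
  set QU := QkW L m n φ U hL αU hα1 hU1 hreg (c₀ := c₀) (c₁ := c₁) with hQU
  set Q1 := QkW L m n φ (fun _ : Bond d (towerP L m (n + 1)) => (1 : 𝔸ˣ)) hL (fun _ => 0) (fun _ => by norm_num)
    (perCfg_UlevOf_one_mem_U1 L m (n + 1)) (norm_Wcx_UlevOf_one_sub_one_le L m (n + 1) (fun _ => 0) (fun _ => le_rfl)) (c₀ := c₀) (c₁ := c₁) with hQ1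
  -- the CLMs
  obtain ⟨TGU, hTGU⟩ : ∃ T : BondL2K ℂ d (towerP L m (n + 1)) c₀ W →L[ℂ] BondL2K ℂ d (towerP L m (n + 1)) c₀ W, T = LinearMap.toContinuousLinearMap GU := ⟨_, rfl⟩
  obtain ⟨TG1, hTG1⟩ : ∃ T : BondL2K ℂ d (towerP L m (n + 1)) c₀ W →L[ℂ] BondL2K ℂ d (towerP L m (n + 1)) c₀ W, T = LinearMap.toContinuousLinearMap G1 := ⟨_, rfl⟩
  obtain ⟨TGd, hTGd⟩ : ∃ T : BondL2K ℂ d (towerP L m (n + 1)) c₀ W →L[ℂ] BondL2K ℂ d (towerP L m (n + 1)) c₀ W, T = LinearMap.toContinuousLinearMap (GU - G1) :=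
    ⟨_, rfl⟩
  obtain ⟨TQ1, hTQ1⟩ : ∃ T : BondL2K ℂ d (towerP L m (n + 1)) c₀ W →L[ℂ] BondL2K ℂ d m c₁ W, T = LinearMap.toContinuousLinearMap Q1 := ⟨_, rfl⟩
  obtain ⟨TQd, hTQd⟩ : ∃ T : BondL2K ℂ d (towerP L m (n + 1)) c₀ W →L[ℂ] BondL2K ℂ d m c₁ W, T = LinearMap.toContinuousLinearMap (QU - Q1) := ⟨_, rfl⟩
  obtain ⟨SU, hSU⟩ : ∃ T : BondL2K ℂ d m c₁ W →L[ℂ] BondL2K ℂ d (towerP L m (n + 1)) c₀ W, T = LinearMap.toContinuousLinearMap (LinearMap.adjoint QU) := ⟨_, rfl⟩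
  obtain ⟨Sd, hSd⟩ : ∃ T : BondL2K ℂ d m c₁ W →L[ℂ] BondL2K ℂ d (towerP L m (n + 1)) c₀ W,
      T = LinearMap.toContinuousLinearMap (LinearMap.adjoint QU - LinearMap.adjoint Q1) := ⟨_, rfl⟩
  -- (1) the flat class data for the MODEL row at `(fun _ => 1)`, `α := 0`
  have hUε1 : ∀ (j : ℕ) (b' : Bond d (towerP L m (j + 1))), ‖(UlevOf L m (n + 1) (fun _ : Bond d (towerP L m (n + 1)) => (1 : 𝔸ˣ)) j b' : 𝔸) - 1‖ ≤ (fun _ : ℕ => (0 : ℝ)) j :=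
    fun j b' => by rw [UlevOf_one]; simp
  have hLb1 : ∀ (j : ℕ) (b' : Bond d (towerP L m (j + 1))), UlevOf L m (n + 1) (fun _ : Bond d (towerP L m (n + 1)) => (1 : 𝔸ˣ)) j b' ∈ U1 𝔸 := fun j b' => by
    rw [UlevOf_one]; exact one_mem _
  have hRlev1 : ∀ (j : ℕ) (b' : Bond d (towerP L m (j + 1))) (w : W), ‖adTransportW φ (UlevOf L m (n + 1) (fun _ : Bond d (towerP L m (n + 1)) => (1 : 𝔸ˣ)) j) b' w‖ ≤ ‖w‖ :=
    fun j b' w => by rw [UlevOf_one, B5Eq172HodgePositivity.adTransportW_one, LinearMap.id_apply]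
  have hUst1 : ∀ b' : Bond d (towerP L m (n + 1)), star ((fun _ : Bond d (towerP L m (n + 1)) => (1 : 𝔸ˣ)) b' : 𝔸) =
      ((((fun _ : Bond d (towerP L m (n + 1)) => (1 : 𝔸ˣ)) b')⁻¹ : 𝔸ˣ) : 𝔸) := fun _ => by simp
  have hUb1 : ∀ b' : Bond d (towerP L m (n + 1)), (fun _ : Bond d (towerP L m (n + 1)) => (1 : 𝔸ˣ)) b' ∈ U1 𝔸 := fun _ => one_mem _
  have hUη1 : ∀ b' : Bond d (towerP L m (n + 1)), ‖((fun _ : Bond d (towerP L m (n + 1)) => (1 : 𝔸ˣ)) b' : 𝔸) - 1‖ ≤ 0 * η := fun _ => by simp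
  have hpl1 : ∀ p : B9SectCLatticeCarrier.Plaq d (towerP L m (n + 1)), ‖(plaqHolU (fun _ : Bond d (towerP L m (n + 1)) => (1 : 𝔸ˣ)) p : 𝔸) - 1‖ ≤ 0 * η ^ 2 := fun _ => by
    simp [plaqHolU_one]
  have hUgrad1 : ∀ (x : TSite d (towerP L m (n + 1))) (μ : Fin d), ‖((fun _ : Bond d (towerP L m (n + 1)) => (1 : 𝔸ˣ)) (x, μ) : 𝔸) -
      (fun _ : Bond d (towerP L m (n + 1)) => (1 : 𝔸ˣ)) (unshift μ x, μ)‖ ≤ 0 * η ^ 2 := fun _ _ => by simp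
  have hεg1 : ∀ j < n + 1, (fun _ : ℕ => (0 : ℝ)) j ≤ 0 * (1 / 2 : ℝ) ^ j := fun _ _ => by simp
  have hAQ1 : ∑ j ∈ Finset.range (n + 1), (fun _ : ℕ => (0 : ℝ)) j ≤ 0 := by simp
  -- (2) the seven letters, all at rate `κ₀`
  have hweak : ∀ {r' : ℝ} (t : ℝ), κ₀ ≤ r' → 0 ≤ t → Real.exp (-(r' * t)) ≤ Real.exp (-(κ₀ * t)) := fun t hr ht => Real.exp_le_exp.mpr (by nlinarith)
  have hcomp : ∀ {D : ℝ}, D ≤ 1 → (1 : ℝ) ≤ Real.exp κ₀ * Real.exp (-(κ₀ * D)) := fun {D} hD => by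
    rw [← Real.exp_add]; exact Real.one_le_exp (by nlinarith [mul_le_mul_of_nonneg_left hD hκ₀0.le])
  -- (L)(G₁,k(U); BG, κ₀)
  have hLGU : ∀ (v : TSite d m) (f : BondL2K ℂ d (towerP L m (n + 1)) c₀ W) (F : ℝ), (∀ x, piB x ≠ v → WL2.equiv ℂ (fun _ : Bond d (towerP L m (n + 1)) => c₀) W f x = 0) →
      (∀ x, ‖WL2.equiv ℂ (fun _ : Bond d (towerP L m (n + 1)) => c₀) W f x‖ ≤ F) →
      ∀ b', ‖WL2.equiv ℂ (fun _ : Bond d (towerP L m (n + 1)) => c₀) W (TGU f) b'‖ ≤ BG * Real.exp (-(κ₀ * tdist m (piB b') v)) * F := by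
    intro v f F hfv hfF b'
    have hF : 0 ≤ F := (norm_nonneg _).trans (hfF b')
    rw [hTGU, LinearMap.coe_toContinuousLinearMap']
    refine (ROWU n η hηL c₀ c₁ hw hρ m hm U αU hα0U hα1 hU1 hreg εU hε0 hlev hlev1 α hα hαG' hUst hUb hUη hpl hUgrad hRlev hεr hAQ hposU' hposU
      v f F hfv hfF b').trans ?_
    exact mul_le_mul_of_nonneg_right (mul_le_mul_of_nonneg_left (hweak _ hκ₀G (tdist_nonneg m _ _)) hBG) hF
  -- (L)(G₁,k(1); B1, κ₀)
  have hLG1 : ∀ (v : TSite d m) (f : BondL2K ℂ d (towerP L m (n + 1)) c₀ W) (F : ℝ), (∀ x, piB x ≠ v → WL2.equiv ℂ (fun _ : Bond d (towerP L m (n + 1)) => c₀) W f x = 0) →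
      (∀ x, ‖WL2.equiv ℂ (fun _ : Bond d (towerP L m (n + 1)) => c₀) W f x‖ ≤ F) →
      ∀ b', ‖WL2.equiv ℂ (fun _ : Bond d (towerP L m (n + 1)) => c₀) W (TG1 f) b'‖ ≤ B1 * Real.exp (-(κ₀ * tdist m (piB b') v)) * F := by
    intro v f F hfv hfF b'
    have hF : 0 ≤ F := (norm_nonneg _).trans (hfF b')
    rw [hTG1, LinearMap.coe_toContinuousLinearMap']
    refine (ROW1 n η hηL c₀ c₁ hw hρ m hm (fun _ : Bond d (towerP L m (n + 1)) => (1 : 𝔸ˣ)) (fun _ => 0) (fun _ => le_rfl) (fun _ => by norm_num)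
      (perCfg_UlevOf_one_mem_U1 L m (n + 1)) (norm_Wcx_UlevOf_one_sub_one_le L m (n + 1) (fun _ => 0) (fun _ => le_rfl)) (fun _ => 0) (fun _ => le_rfl) hUε1 hLb1
      0 le_rfl hα₁.le hUst1 hUb1 hUη1 hpl1 hUgrad1 hRlev1 hεg1 hAQ1 hpos'₁ hpos₁ v f F hfv hfF b').trans ?_
    exact mul_le_mul_of_nonneg_right (mul_le_mul_of_nonneg_left (hweak _ hκ₀1 (tdist_nonneg m _ _)) hB1) hF
  -- (L)(G₁,k(U) − G₁,k(1); KS·α, κ₀)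
  have hLGd : ∀ (v : TSite d m) (f : BondL2K ℂ d (towerP L m (n + 1)) c₀ W) (F : ℝ), (∀ x, piB x ≠ v → WL2.equiv ℂ (fun _ : Bond d (towerP L m (n + 1)) => c₀) W f x = 0) →
      (∀ x, ‖WL2.equiv ℂ (fun _ : Bond d (towerP L m (n + 1)) => c₀) W f x‖ ≤ F) →
      ∀ b', ‖WL2.equiv ℂ (fun _ : Bond d (towerP L m (n + 1)) => c₀) W (TGd f) b'‖ ≤ (KS * α) * Real.exp (-(κ₀ * tdist m (piB b') v)) * F := by
    intro v f F hfv hfF b'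
    have hF : 0 ≤ F := (norm_nonneg _).trans (hfF b')
    rw [hTGd, LinearMap.coe_toContinuousLinearMap', LinearMap.sub_apply]
    refine (HS n η hηL c₀ c₁ hw hρ m hm U α hα hαS' hUb hUη hUw hpl hUst αU hα0U hα1 hAQ hU1 hreg εU hε0 hε1 hεr hlev hlev1 hRlev hposU' hposU hpos'₁ hpos₁
      v f F hfv hfF b').trans ?_
    exact mul_le_mul_of_nonneg_right (mul_le_mul_of_nonneg_left (hweak _ hκ₀S (tdist_nonneg m _ _)) (mul_nonneg hKS hα)) hF
  -- (L)(Q_k(1); KQ1, κ₀)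
  have hLQ1 : ∀ (v : TSite d m) (f : BondL2K ℂ d (towerP L m (n + 1)) c₀ W) (F : ℝ), (∀ x, piB x ≠ v → WL2.equiv ℂ (fun _ : Bond d (towerP L m (n + 1)) => c₀) W f x = 0) →
      (∀ x, ‖WL2.equiv ℂ (fun _ : Bond d (towerP L m (n + 1)) => c₀) W f x‖ ≤ F) →
      ∀ c', ‖WL2.equiv ℂ (fun _ : Bond d m => c₁) W (TQ1 f) c'‖ ≤ KQ1 * Real.exp (-(κ₀ * tdist m (piC c') v)) * F := by
    intro v f F hfv hfF c'
    rw [hTQ1, LinearMap.coe_toContinuousLinearMap']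
    have h := local_QkW L m n φ (fun _ : Bond d (towerP L m (n + 1)) => (1 : 𝔸ˣ)) hL (fun _ => 0) (fun _ => by norm_num)
      (perCfg_UlevOf_one_mem_U1 L m (n + 1)) (norm_Wcx_UlevOf_one_sub_one_le L m (n + 1) (fun _ => 0) (fun _ => le_rfl)) (c₀ := c₀) (c₁ := c₁)
      hφ hφ' hMφ hMφ' hm hκ₀0.le v f F hfv hfF c'
    simp only [mul_zero, add_zero, Finset.prod_const_one, mul_one] at h
    exact h.trans (le_of_eq (by rw [hKQ1]))
  -- (L)(Q_k(U) − Q_k(1); KQd·α, κ₀)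
  have hPA : ∏ j ∈ Finset.range (n + 1), (1 + 50 * ((d : ℝ) + 1) * αU j) ≤ Real.exp (50 * ((d : ℝ) + 1) * AQ) := by
    calc ∏ j ∈ Finset.range (n + 1), (1 + 50 * ((d : ℝ) + 1) * αU j) ≤ ∏ j ∈ Finset.range (n + 1), Real.exp (50 * ((d : ℝ) + 1) * αU j) :=
          Finset.prod_le_prod (fun j _ => by have := hα0U j; positivity) fun j _ => by linarith [Real.add_one_le_exp (50 * ((d : ℝ) + 1) * αU j)]
      _ = Real.exp (50 * ((d : ℝ) + 1) * ∑ j ∈ Finset.range (n + 1), αU j) := by rw [← Real.exp_sum, Finset.mul_sum]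
      _ ≤ Real.exp (50 * ((d : ℝ) + 1) * AQ) := Real.exp_le_exp.mpr (mul_le_mul_of_nonneg_left hAQ (by positivity))
  have hSε : ∑ j ∈ Finset.range (n + 1), εU j ≤ α * (1 / (1 - r)) := by
    have h1 : ∑ j ∈ Finset.range (n + 1), εU j ≤ ∑ j ∈ Finset.range (n + 1), α * r ^ j :=
      Finset.sum_le_sum fun j hj => hεr j (Finset.mem_range.mp hj)
    have h2 : ∑ j ∈ Finset.range (n + 1), α * r ^ j ≤ α * (1 / (1 - r)) := by
      rw [← Finset.mul_sum]
      refine mul_le_mul_of_nonneg_left ?_ hα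
      have h := geom_sum_Ico_le_of_lt_one (m := 0) (n := n + 1) hr0 hr1
      rw [pow_zero] at h
      rw [Finset.range_eq_Ico]
      exact h.trans (le_of_eq (by ring))
    exact h1.trans h2
  have hLQd : ∀ (v : TSite d m) (f : BondL2K ℂ d (towerP L m (n + 1)) c₀ W) (F : ℝ), (∀ x, piB x ≠ v → WL2.equiv ℂ (fun _ : Bond d (towerP L m (n + 1)) => c₀) W f x = 0) →
      (∀ x, ‖WL2.equiv ℂ (fun _ : Bond d (towerP L m (n + 1)) => c₀) W f x‖ ≤ F) →
      ∀ c', ‖WL2.equiv ℂ (fun _ : Bond d m => c₁) W (TQd f) c'‖ ≤ (KQd * α) * Real.exp (-(κ₀ * tdist m (piC c') v)) * F := by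
    intro v f F hfv hfF c'
    have hF : 0 ≤ F := (norm_nonneg _).trans (hfF (fun _ => 0, ⟨0, hd⟩))
    rw [hTQd, LinearMap.coe_toContinuousLinearMap', LinearMap.sub_apply, WL2.equiv_sub, Pi.sub_apply]
    have h := local_QkW_sub_flat L m n φ U hL αU hα0U hα1 hU1 hreg εU hε0 hlev (c₀ := c₀) (c₁ := c₁) hφ hφ' hMφ hMφ' hm hκ₀0.le v f hF hfv hfF c'
    refine h.trans ?_
    calc Mφ' * Mφ * ((∏ j ∈ Finset.range (n + 1), (1 + 50 * ((d : ℝ) + 1) * αU j)) * (102 * ((d : ℝ) + 1) ^ 2 * L) * (∑ j ∈ Finset.range (n + 1), εU j)) *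
          Real.exp κ₀ * Real.exp (-(κ₀ * tdist m (bpos c') v)) * F
        = Mφ' * Mφ * ((∏ j ∈ Finset.range (n + 1), (1 + 50 * ((d : ℝ) + 1) * αU j)) * θ * (∑ j ∈ Finset.range (n + 1), εU j)) *
          (Real.exp κ₀ * Real.exp (-(κ₀ * tdist m (bpos c') v)) * F) := by rw [hθ]; ring
      _ ≤ Mφ' * Mφ * (Real.exp (50 * ((d : ℝ) + 1) * AQ) * θ * (α * (1 / (1 - r)))) * (Real.exp κ₀ * Real.exp (-(κ₀ * tdist m (bpos c') v)) * F) := by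
          have hP0 : 0 ≤ ∏ j ∈ Finset.range (n + 1), (1 + 50 * ((d : ℝ) + 1) * αU j) := Finset.prod_nonneg fun j _ => by have := hα0U j; positivity
          have hS0' : 0 ≤ ∑ j ∈ Finset.range (n + 1), εU j := Finset.sum_nonneg fun j _ => hε0 j
          gcongr
      _ = (KQd * α) * Real.exp (-(κ₀ * tdist m (piC c') v)) * F := by rw [hKQd, hpiC]; simp only [bpos]; ring
  -- (L)(Q_k(U)†; KSU, κ₀) and (L)(Q_k(U)† − Q_k(1)†; KSd·α, κ₀) on coarse-bond sources
  have hzone : ∀ (w : TSite d m) (h : BondL2K ℂ d m c₁ W) (H : ℝ), (∀ c', piC c' ≠ w → WL2.equiv ℂ (fun _ : Bond d m => c₁) W h c' = 0) →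
      (∀ c', ‖WL2.equiv ℂ (fun _ : Bond d m => c₁) W h c'‖ ≤ H) → ∀ (b' : Bond d (towerP L m (n + 1))) (c' : Bond d m),
      (blockCoord (L ^ (n + 1)) m (siteCast (towerP_eq_fineP_pow L m (n + 1)) b'.1) = c'.1 ∨
        blockCoord (L ^ (n + 1)) m (siteCast (towerP_eq_fineP_pow L m (n + 1)) b'.1) = shift c'.2 c'.1) →
      ‖WL2.equiv ℂ (fun _ : Bond d m => c₁) W h c'‖ ≤ Real.exp κ₀ * Real.exp (-(κ₀ * tdist m (piB b') w)) * H := by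
    intro w h H hhv hhF b' c' hc
    have hH : 0 ≤ H := (norm_nonneg _).trans (hhF c')
    by_cases hcw : c'.1 = w
    · have hD : tdist m (piB b') w ≤ 1 := by
        show tdist m (blockCoord (L ^ (n + 1)) m (siteCast (towerP_eq_fineP_pow L m (n + 1)) b'.1)) w ≤ 1
        rcases hc with hc | hc
        · rw [hc, hcw, tdist_self]; exact zero_le_one
        · rw [hc, ← hcw, tdist_symm hm]; exact tdist_shift_le_one hm c'.1 c'.2
      calc ‖WL2.equiv ℂ (fun _ : Bond d m => c₁) W h c'‖ ≤ 1 * H := by rw [one_mul]; exact hhF c'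
        _ ≤ (Real.exp κ₀ * Real.exp (-(κ₀ * tdist m (piB b') w))) * H := mul_le_mul_of_nonneg_right (hcomp hD) hH
        _ = _ := by ring
    · rw [hhv c' hcw, norm_zero]; positivity
  have hLSU : ∀ (w : TSite d m) (h : BondL2K ℂ d m c₁ W) (H : ℝ), (∀ c', piC c' ≠ w → WL2.equiv ℂ (fun _ : Bond d m => c₁) W h c' = 0) →
      (∀ c', ‖WL2.equiv ℂ (fun _ : Bond d m => c₁) W h c'‖ ≤ H) →
      ∀ b', ‖WL2.equiv ℂ (fun _ : Bond d (towerP L m (n + 1)) => c₀) W (SU h) b'‖ ≤ KSU * Real.exp (-(κ₀ * tdist m (piB b') w)) * H := by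
    intro w h H hhv hhF b'
    have hH : 0 ≤ H := (norm_nonneg _).trans (hhF (w, ⟨0, hd⟩))
    rw [hSU, LinearMap.coe_toContinuousLinearMap']
    have hM : 0 ≤ Real.exp κ₀ * Real.exp (-(κ₀ * tdist m (piB b') w)) * H := by positivity
    have h1 := norm_adjoint_QkW_apply_le_local_sharp (c₀ := c₀) (c₁ := c₁) L m n φ U hL αU hα0U hα1 hU1 hreg hMφ hφ hMφ' hφ' hAQ h b' hM
      (hzone w h H hhv hhF b')
    have he : c₁ / c₀ * (Mφ' * ((((L : ℝ) ^ (n + 1)) ^ d)⁻¹ * Real.exp (100 * d * (d + 1) * (L : ℝ) ^ d * AQ)) * Mφ) = Mφ' * Mφ * EA := by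
      rw [hEA, ← hw]; field_simp
    rw [he] at h1
    exact h1.trans (le_of_eq (by rw [hKSU]; ring))
  have hLSd : ∀ (w : TSite d m) (h : BondL2K ℂ d m c₁ W) (H : ℝ), (∀ c', piC c' ≠ w → WL2.equiv ℂ (fun _ : Bond d m => c₁) W h c' = 0) →
      (∀ c', ‖WL2.equiv ℂ (fun _ : Bond d m => c₁) W h c'‖ ≤ H) →
      ∀ b', ‖WL2.equiv ℂ (fun _ : Bond d (towerP L m (n + 1)) => c₀) W (Sd h) b'‖ ≤ (KSd * α) * Real.exp (-(κ₀ * tdist m (piB b') w)) * H := by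
    intro w h H hhv hhF b'
    have hH : 0 ≤ H := (norm_nonneg _).trans (hhF (w, ⟨0, hd⟩))
    rw [hSd, LinearMap.coe_toContinuousLinearMap', LinearMap.sub_apply, WL2.equiv_sub, Pi.sub_apply]
    have hM : 0 ≤ Real.exp κ₀ * Real.exp (-(κ₀ * tdist m (piB b') w)) * H := by positivity
    have h1 := norm_adjoint_QkW_sub_flat_apply_le_local_diagonal L m n φ U hL αU hα0U hα1 hU1 hreg εU hε0 hlev hr0 hr1 hα hεr hMφ hφ hMφ' hφ' hAQ hw h b' hM
      (hzone w h H hhv hhF b')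
    exact h1.trans (le_of_eq (by rw [hKSd, hEA]; ring))
  -- (3) the three words, two compositions each (row sum `S = K_d(κ₀/2)`)
  have hrow : ∀ w : TSite d m, ∑ u, Real.exp (-((κ₀ - κ₀ / 2) * tdist m w u)) ≤ S := fun w => by
    rw [show κ₀ - κ₀ / 2 = κ₀ / 2 by ring]; exact torusSum_le d hm (half_pos hκ₀0) w
  have hδ0 : ∀ u v : TSite d m, 0 ≤ tdist m u v := fun u v => tdist_nonneg _ _ _
  have hδt : ∀ u y v : TSite d m, tdist m u v ≤ tdist m u y + tdist m y v := fun u y v => tdist_triangle hm u y v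
  have hκ'0 : (0 : ℝ) ≤ κ₀ / 2 := by positivity
  have hκ'1 : κ₀ / 2 ≤ κ₀ := by linarith
  -- word 1: `(Q(U) − Q(1)) G(U) Q(U)†`
  have hW1a := letter_comp (𝕜 := ℂ) (tdist m) piC piB piB SU TGU hδ0 hδt hKSU0 hBG hκ'0 hκ'1 hLSU hLGU hrow
  have hW1 := letter_comp (𝕜 := ℂ) (tdist m) piC piB piC (TGU ∘L SU) TQd hδ0 hδt (by positivity) (mul_nonneg hKQd0 hα) hκ'0 le_rfl hW1a hLQd hrow
  -- word 2: `Q(1) (G(U) − G(1)) Q(U)†`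
  have hW2a := letter_comp (𝕜 := ℂ) (tdist m) piC piB piB SU TGd hδ0 hδt hKSU0 (mul_nonneg hKS hα) hκ'0 hκ'1 hLSU hLGd hrow
  have hW2 := letter_comp (𝕜 := ℂ) (tdist m) piC piB piC (TGd ∘L SU) TQ1 hδ0 hδt (by positivity) hKQ10 hκ'0 le_rfl hW2a hLQ1 hrow
  -- word 3: `Q(1) G(1) (Q(U)† − Q(1)†)`
  have hW3a := letter_comp (𝕜 := ℂ) (tdist m) piC piB piB Sd TG1 hδ0 hδt (mul_nonneg hKSd0 hα) hB1 hκ'0 hκ'1 hLSd hLG1 hrow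
  have hW3 := letter_comp (𝕜 := ℂ) (tdist m) piC piB piC (TG1 ∘L Sd) TQ1 hδ0 hδt (by positivity) hKQ10 hκ'0 le_rfl hW3a hLQ1 hrow
  -- (4) the telescoping identity
  have hsplit : QU (GU (LinearMap.adjoint QU z)) - Q1 (G1 (LinearMap.adjoint Q1 z)) =
      ((TQd ∘L (TGU ∘L SU)) + (TQ1 ∘L (TGd ∘L SU)) + (TQ1 ∘L (TG1 ∘L Sd))) z := by
    simp only [add_apply, ContinuousLinearMap.coe_comp, Function.comp_apply]
    rw [hTGU, hTG1, hTGd, hTQ1, hTQd, hSU, hSd]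
    simp only [LinearMap.coe_toContinuousLinearMap']
    simp only [LinearMap.sub_apply, map_sub]
    abel
  rw [hsplit]
  have h12 := letter_add (𝕜 := ℂ) (tdist m) piC piC _ _ hW1 hW2
  have h123 := letter_add (𝕜 := ℂ) (tdist m) piC piC _ _ h12 hW3 v z F hzv hzF c
  refine h123.trans (le_of_eq ?_)
  simp only [hK, hpiC]
  ring

end Literature.MathematicalPhysics.QuantumFieldTheory.Balaban1983to89.B9Eq3126KTwoBackgroundLetterTower

end
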